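import Summits.KontsevichZagierPeriods.KontsevichZagierPeriods.Theses.HodgeColevel
import Summits.KontsevichZagierPeriods.KontsevichZagierPeriods.Theses.HodgeLevel
import Summits.KontsevichZagierPeriods.KontsevichZagierPeriods.Theorems.AbelContractionAreasToArcs
import Summits.KontsevichZagierPeriods.KontsevichZagierPeriods.Theorems.HodgeColevelSameDegreeStrength

/-!
# Route HodgeColevel — placement of `SameDegreeOne` (stmt-KontsevichZagierPeriods-6182) between existing items

Crux-strategist evidence for `DegreeCompression` (stmt-KontsevichZagierPeriods-6177), decomposition
heading of `Cruxes/DegreeCompression/STRATEGY-CENSUS.md` (q1): the dimension-wise split of the crux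
(`≡ S ≡ SameDegreeConjecture`, `Theorems/HodgeColevelSameDegreeStrength`) reads
`S ⟸ SameDegreeOne ∧ SDC_{≥2}`; this file shows that its lower piece is NOT new — it is sandwiched
between items already on the ledger:

  `KontsevichZagierPeriods ⟹ PlanarAreas (stmt-4990, five routes) ⟹ SameDegreeOne (stmt-6182) ⟹ zero form in dimension 1`,

the middle implication being the landed areas-to-arcs theorem
`AbelContraction.AreasToArcs.equivalent_of_value_eq_of_planarAreas` (item stmt-0117, proved): planar
Hilbert III inside the rules gives Conjecture 1 for ALL pairs of one-dimensional representations, of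
which `SameDegreeOne` is the sub-case with (superfluous) incompressibility hypotheses.  Consequently the
split's only new piece is the top one, `SDC_{≥2}`, and `PlanarAreas ∧ SDC_{≥2} → S`
(`kontsevichZagierPeriods_of_planarAreas_of_twoUp`).

Sources: M. Kontsevich, D. Zagier, *Periods* (2001), §1.2; A. Huber, G. Wüstholz, *Transcendence and
linear relations of 1-periods* (2022), Thm 13.3.  Tree: `Theorems/AbelContractionAreasToArcs`,
`Theorems/HodgeColevelSameDegreeStrength`.
-/

noncomputable section

open Literature.NumberTheory.Transcendental
open Summit.KontsevichZagierPeriods.KontsevichZagierPeriods.Theses.HodgeColevel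
  (SameDegreeOne SameDegreeConjecture DegreeCompression)

namespace Summit.KontsevichZagierPeriods.HodgeColevel.SameDegreeOnePlacement

/-- **`PlanarAreas → SameDegreeOne`**: areas-to-arcs (`equivalent_of_value_eq_of_planarAreas`,
item stmt-0117) makes any two `1`-dimensional representations of equal value equivalent; drop the
incompressibility hypotheses. [Kontsevich–Zagier 2001, §1.2] [folklore] -/
theorem sameDegreeOne_of_planarAreas
    (hP : Summit.KontsevichZagierPeriods.KontsevichZagierPeriods.Theses.HodgeLevel.PlanarAreas) :
    SameDegreeOne :=
  fun r r' _ _ hv =>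
    Summit.KontsevichZagierPeriods.AbelContraction.AreasToArcs.equivalent_of_value_eq_of_planarAreas
      hP r r' hv

/-- `KontsevichZagierPeriods → PlanarAreas` (the semialgebraic two-representation form of the summit,
`kzPeriodConjecture'_iff_isRational`). [Kontsevich–Zagier 2001, §1.2] [folklore] -/
theorem planarAreas_of_kontsevichZagierPeriods (h : KontsevichZagierPeriods) :
    Summit.KontsevichZagierPeriods.KontsevichZagierPeriods.Theses.HodgeLevel.PlanarAreas :=
  fun r r' _ _ hv => kzPeriodConjecture'_iff_isRational.mpr (KontsevichZagierPeriods_iff.mp h) r r' hv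

/-- `KontsevichZagierPeriods → SameDegreeOne` (through `PlanarAreas`, or directly).
[Kontsevich–Zagier 2001, §1.2] [folklore] -/
theorem sameDegreeOne_of_kontsevichZagierPeriods (h : KontsevichZagierPeriods) : SameDegreeOne :=
  sameDegreeOne_of_planarAreas (planarAreas_of_kontsevichZagierPeriods h)

/-- `PlanarAreas` already gives zero form in dimension `1` (every `1`-dimensional representation of
value `0` is null), via `SameDegreeOne` and the sign trick (`SameDegreeStrength.of_mem_relations_of_dim_one`)
— or directly against the empty representation. [Kontsevich–Zagier 2001, §1.2] [folklore] -/
theorem of_mem_relations_of_dim_one_of_planarAreas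
    (hP : Summit.KontsevichZagierPeriods.KontsevichZagierPeriods.Theses.HodgeLevel.PlanarAreas)
    (s : KZ.IntegralRep 1) (hs0 : s.value = 0) : KZ.of s ∈ KZ.relations :=
  SameDegreeStrength.of_mem_relations_of_dim_one (sameDegreeOne_of_planarAreas hP) s hs0

/-- **The dimension-wise split with its lower piece replaced by the existing item**:
`PlanarAreas ∧ SDC_{≥2} → KontsevichZagierPeriods`. [Kontsevich–Zagier 2001, §1.2 Conjecture 1] [folklore] -/
theorem kontsevichZagierPeriods_of_planarAreas_of_twoUp
    (hP : Summit.KontsevichZagierPeriods.KontsevichZagierPeriods.Theses.HodgeLevel.PlanarAreas)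
    (h2 : ∀ d : ℕ, 2 ≤ d → ∀ r r' : KZ.IntegralRep d,
      (∀ k < d, ∀ t : KZ.IntegralRep k, ¬ KZ.Equivalent r t) →
      (∀ k < d, ∀ t : KZ.IntegralRep k, ¬ KZ.Equivalent r' t) → r.value = r'.value → KZ.Equivalent r r') :
    KontsevichZagierPeriods :=
  SameDegreeStrength.kontsevichZagierPeriods_of_sameDegreeOne_of_twoUp (sameDegreeOne_of_planarAreas hP) h2

end Summit.KontsevichZagierPeriods.HodgeColevel.SameDegreeOnePlacement

end
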